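import Mathlib
import HarnessLib
import Summits.HubbardSuperconductivity.HubbardSuperconductivity.Theorems.KLProgrammeDefs

/-!
# Route `KLProgramme` — support item `CountPairsOffset` (stmt-HubbardSuperconductivity-20036):
# calculus of the offset level function

Periodicity of `h_P` and `∂₃ h_P` on the grid, the value on the exact anti-diagonal (`h_P(θ, θ + π) = ε₂(P) - μ`), the
derivatives of `h_P` along the fibres used by the counting scheme (`θ₃`-fibre, shift line `θ₃ = θ₂ + c`, anti-diagonal
`(σ - t/2, σ + t/2)`, diagonal, and the `t`-derivative of `G_P`) and their uniform bounds over a `BandBounds` bundle.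
Verbatim analogues, for an arbitrary offset `P ∈ ℝ²`, of the fixed-curve-point lemmas of
`Literature/…/HubbardBandSectorCountingToolbox.lean` (the offset enters every proof as an additive constant only).
References: G. Benfatto, A. Giuliani, V. Mastropietro, Ann. Henri Poincaré 7 (2006) 809–898, Lemma 3.1, (2.76), (2.80),
App. A2; Ann. Henri Poincaré 4 (2003) 137–193, §7. Mathematics: HOME/prover-p4/COUNTING-NOTE.md (cell gate-hubbard-kl).
-/

noncomputable section

namespace Summit.HubbardSuperconductivity.HubbardSuperconductivity.Theorems.CountPairsOffset

set_option linter.dupNamespace false -- summit = problem name (single-conjunct summit), D-0017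

open Real Set
open Literature.MathematicalPhysics.QuantumLattice Literature.MathematicalPhysics.QuantumLattice.BandSectorCounting

/-! ### Periodicity on the grid -/

section Periodic

variable {μ : ℝ} (hμ₁ : -4 < μ) (hμ₂ : μ < 0)
include hμ₁ hμ₂

/-- `h_P` is `2π`-periodic in `θ₃`. -/
theorem hfunP_add_two_pi_three (P : ℝ × ℝ) (θ₂ θ₃ : ℝ) (m : ℤ) :
    hfunP μ P θ₂ (θ₃ + m * (2 * π)) = hfunP μ P θ₂ θ₃ := by
  obtain ⟨hx, hy, -, -⟩ := band_add_int_mul_two_pi hμ₁ hμ₂ θ₃ m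
  unfold hfunP SXP SYP; rw [hx, hy]

/-- `h_P` is `2π`-periodic in `θ₂`. -/
theorem hfunP_add_two_pi_two (P : ℝ × ℝ) (θ₂ θ₃ : ℝ) (m : ℤ) :
    hfunP μ P (θ₂ + m * (2 * π)) θ₃ = hfunP μ P θ₂ θ₃ := by
  rw [hfunP_swap, hfunP_add_two_pi_three hμ₁ hμ₂, hfunP_swap]

/-- `∂₃ h_P` is `2π`-periodic in `θ₃`. -/
theorem h3P_add_two_pi_three (P : ℝ × ℝ) (θ₂ θ₃ : ℝ) (m : ℤ) :
    h3P μ P θ₂ (θ₃ + m * (2 * π)) = h3P μ P θ₂ θ₃ := by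
  obtain ⟨hx, hy, hvx, hvy⟩ := band_add_int_mul_two_pi hμ₁ hμ₂ θ₃ m
  unfold h3P SXP SYP; rw [hx, hy, hvx, hvy]

/-- `∂₃ h_P` is `2π`-periodic in `θ₂`. -/
theorem h3P_add_two_pi_two (P : ℝ × ℝ) (θ₂ θ₃ : ℝ) (m : ℤ) :
    h3P μ P (θ₂ + m * (2 * π)) θ₃ = h3P μ P θ₂ θ₃ := by
  obtain ⟨hx, hy, -, -⟩ := band_add_int_mul_two_pi hμ₁ hμ₂ θ₂ m
  unfold h3P SXP SYP; rw [hx, hy]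

/-- On the exact anti-diagonal the momentum sum is the offset: `h_P(θ, θ + π) = ε₂(P) - μ`. -/
theorem hfunP_add_pi (P : ℝ × ℝ) (θ₂ : ℝ) : hfunP μ P θ₂ (θ₂ + π) = eps2 P.1 P.2 - μ := by
  obtain ⟨hx, hy, -, -⟩ := band_add_pi hμ₁ hμ₂ θ₂
  unfold hfunP SXP SYP
  rw [hx, hy, show P.1 + bandX μ θ₂ + -bandX μ θ₂ = P.1 by ring, show P.2 + bandY μ θ₂ + -bandY μ θ₂ = P.2 by ring]

end Periodic

/-! ### Derivatives along the fibres -/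


section Deriv

variable {μ : ℝ} (hμ₁ : -4 < μ) (hμ₂ : μ < 0)
include hμ₁ hμ₂

/-- `∂₃ h` is the derivative of `h` in `θ₃`. -/
theorem hasDerivAt_hfunP_three (P : ℝ × ℝ) (θ₂ θ₃ : ℝ) :
    HasDerivAt (fun x => hfunP μ P θ₂ x) (h3P μ P θ₂ θ₃) θ₃ := by
  have hX : HasDerivAt (fun x => SXP μ P θ₂ x) (bandVX μ θ₃) θ₃ := by
    unfold SXP; exact (hasDerivAt_bandX hμ₁ hμ₂ θ₃).const_add _
  have hY : HasDerivAt (fun x => SYP μ P θ₂ x) (bandVY μ θ₃) θ₃ := by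
    unfold SYP; exact (hasDerivAt_bandY hμ₁ hμ₂ θ₃).const_add _
  have h := ((hX.cos.fun_add hY.cos).const_mul (-2)).sub_const μ
  unfold hfunP eps2
  exact h.congr_deriv (by unfold h3P; ring)

/-- `∂₃∂₃ h` is the derivative of `∂₃ h`. -/
theorem hasDerivAt_h3P (P : ℝ × ℝ) (θ₂ θ₃ : ℝ) :
    HasDerivAt (fun x => h3P μ P θ₂ x) (h33P μ P θ₂ θ₃) θ₃ := by
  have hX : HasDerivAt (fun x => SXP μ P θ₂ x) (bandVX μ θ₃) θ₃ := by
    unfold SXP; exact (hasDerivAt_bandX hμ₁ hμ₂ θ₃).const_add _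
  have hY : HasDerivAt (fun x => SYP μ P θ₂ x) (bandVY μ θ₃) θ₃ := by
    unfold SYP; exact (hasDerivAt_bandY hμ₁ hμ₂ θ₃).const_add _
  have h := ((hX.sin.fun_mul (hasDerivAt_bandVX hμ₁ hμ₂ θ₃)).const_mul 2).fun_add
    ((hY.sin.fun_mul (hasDerivAt_bandVY hμ₁ hμ₂ θ₃)).const_mul 2)
  unfold h3P
  refine (h.congr_deriv ?_).congr_of_eventuallyEq ?_
  · unfold h33P; ring
  · exact Filter.Eventually.of_forall fun x => by ring

/-- The derivative of `θ₂ ↦ h(θ₂, θ₂ + c)`. -/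
theorem hasDerivAt_hfunP_diag (P : ℝ × ℝ) (c θ₂ : ℝ) :
    HasDerivAt (fun x => hfunP μ P x (x + c))
      (2 * Real.sin (SXP μ P θ₂ (θ₂ + c)) * (bandVX μ θ₂ + bandVX μ (θ₂ + c)) +
        2 * Real.sin (SYP μ P θ₂ (θ₂ + c)) * (bandVY μ θ₂ + bandVY μ (θ₂ + c))) θ₂ := by
  have hX : HasDerivAt (fun x => SXP μ P x (x + c)) (bandVX μ θ₂ + bandVX μ (θ₂ + c)) θ₂ := by
    unfold SXP
    exact ((hasDerivAt_bandX hμ₁ hμ₂ θ₂).const_add _).fun_add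
      ((hasDerivAt_bandX hμ₁ hμ₂ (θ₂ + c)).comp_add_const θ₂ c)
  have hY : HasDerivAt (fun x => SYP μ P x (x + c)) (bandVY μ θ₂ + bandVY μ (θ₂ + c)) θ₂ := by
    unfold SYP
    exact ((hasDerivAt_bandY hμ₁ hμ₂ θ₂).const_add _).fun_add
      ((hasDerivAt_bandY hμ₁ hμ₂ (θ₂ + c)).comp_add_const θ₂ c)
  have h := ((hX.cos.fun_add hY.cos).const_mul (-2)).sub_const μ
  unfold hfunP eps2
  exact h.congr_deriv (by ring)

/-- The derivative of `t ↦ h(σ - t/2, σ + t/2)`. -/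
theorem hasDerivAt_hfunP_anti (P : ℝ × ℝ) (σ t : ℝ) :
    HasDerivAt (fun s => hfunP μ P (σ - s / 2) (σ + s / 2))
      (Real.sin (SXP μ P (σ - t / 2) (σ + t / 2)) * (bandVX μ (σ + t / 2) - bandVX μ (σ - t / 2)) +
        Real.sin (SYP μ P (σ - t / 2) (σ + t / 2)) * (bandVY μ (σ + t / 2) - bandVY μ (σ - t / 2))) t := by
  have hm : HasDerivAt (fun s : ℝ => σ - s / 2) (-(1 / 2)) t := by
    have := ((hasDerivAt_id' t).div_const 2).const_sub σ
    exact this.congr_deriv (by ring)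
  have hp : HasDerivAt (fun s : ℝ => σ + s / 2) (1 / 2) t := by
    have := ((hasDerivAt_id' t).div_const 2).const_add σ
    exact this.congr_deriv (by ring)
  have hXm₀ := (hasDerivAt_bandX hμ₁ hμ₂ (σ - t / 2)).comp t hm
  have hXm : HasDerivAt (fun s => bandX μ (σ - s / 2)) (bandVX μ (σ - t / 2) * (-(1 / 2))) t := hXm₀
  have hXp₀ := (hasDerivAt_bandX hμ₁ hμ₂ (σ + t / 2)).comp t hp
  have hXp : HasDerivAt (fun s => bandX μ (σ + s / 2)) (bandVX μ (σ + t / 2) * (1 / 2)) t := hXp₀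
  have hYm₀ := (hasDerivAt_bandY hμ₁ hμ₂ (σ - t / 2)).comp t hm
  have hYm : HasDerivAt (fun s => bandY μ (σ - s / 2)) (bandVY μ (σ - t / 2) * (-(1 / 2))) t := hYm₀
  have hYp₀ := (hasDerivAt_bandY hμ₁ hμ₂ (σ + t / 2)).comp t hp
  have hYp : HasDerivAt (fun s => bandY μ (σ + s / 2)) (bandVY μ (σ + t / 2) * (1 / 2)) t := hYp₀
  have hX : HasDerivAt (fun s => SXP μ P (σ - s / 2) (σ + s / 2))
      (bandVX μ (σ - t / 2) * (-(1 / 2)) + bandVX μ (σ + t / 2) * (1 / 2)) t := by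
    unfold SXP; exact (hXm.const_add _).fun_add hXp
  have hY : HasDerivAt (fun s => SYP μ P (σ - s / 2) (σ + s / 2))
      (bandVY μ (σ - t / 2) * (-(1 / 2)) + bandVY μ (σ + t / 2) * (1 / 2)) t := by
    unfold SYP; exact (hYm.const_add _).fun_add hYp
  have h := ((hX.cos.fun_add hY.cos).const_mul (-2)).sub_const μ
  unfold hfunP eps2
  exact h.congr_deriv (by ring)

/-- The derivative of the diagonal function `H(σ) = h(σ, σ)`. -/
theorem hasDerivAt_hfunP_diag_zero (P : ℝ × ℝ) (σ : ℝ) :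
    HasDerivAt (fun x => hfunP μ P x x)
      (4 * (Real.sin (SXP μ P σ σ) * bandVX μ σ + Real.sin (SYP μ P σ σ) * bandVY μ σ)) σ := by
  have h := hasDerivAt_hfunP_diag hμ₁ hμ₂ P 0 σ
  simp only [add_zero] at h
  exact h.congr_deriv (by ring)

/-- The second derivative of the diagonal function. -/
theorem hasDerivAt_hfunP_diag_zero_deriv (P : ℝ × ℝ) (σ : ℝ) :
    HasDerivAt (fun x => 4 * (Real.sin (SXP μ P x x) * bandVX μ x + Real.sin (SYP μ P x x) * bandVY μ x))
      (8 * (Real.cos (SXP μ P σ σ) * bandVX μ σ ^ 2 + Real.cos (SYP μ P σ σ) * bandVY μ σ ^ 2) +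
        4 * (Real.sin (SXP μ P σ σ) * bandAX μ σ + Real.sin (SYP μ P σ σ) * bandAY μ σ)) σ := by
  have hX : HasDerivAt (fun x => SXP μ P x x) (2 * bandVX μ σ) σ := by
    unfold SXP
    have := ((hasDerivAt_bandX hμ₁ hμ₂ σ).const_add P.1).fun_add (hasDerivAt_bandX hμ₁ hμ₂ σ)
    exact this.congr_deriv (by ring)
  have hY : HasDerivAt (fun x => SYP μ P x x) (2 * bandVY μ σ) σ := by
    unfold SYP
    have := ((hasDerivAt_bandY hμ₁ hμ₂ σ).const_add P.2).fun_add (hasDerivAt_bandY hμ₁ hμ₂ σ)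
    exact this.congr_deriv (by ring)
  have h := ((hX.sin.fun_mul (hasDerivAt_bandVX hμ₁ hμ₂ σ)).fun_add
    (hY.sin.fun_mul (hasDerivAt_bandVY hμ₁ hμ₂ σ))).const_mul 4
  exact h.congr_deriv (by ring)

/-- The `t`-derivative of `G`. -/
theorem hasDerivAt_GfunP (P : ℝ × ℝ) (σ t : ℝ) :
    HasDerivAt (fun s => GfunP μ P σ s)
      (2 * (Real.cos (SXP μ P (σ - t / 2) (σ + t / 2)) *
            (bandVX μ (σ - t / 2) * (-(1 / 2)) + bandVX μ (σ + t / 2) * (1 / 2)) *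
            (bandVX μ (σ - t / 2) + bandVX μ (σ + t / 2)) +
          Real.sin (SXP μ P (σ - t / 2) (σ + t / 2)) *
            (bandAX μ (σ - t / 2) * (-(1 / 2)) + bandAX μ (σ + t / 2) * (1 / 2))) +
        2 * (Real.cos (SYP μ P (σ - t / 2) (σ + t / 2)) *
            (bandVY μ (σ - t / 2) * (-(1 / 2)) + bandVY μ (σ + t / 2) * (1 / 2)) *
            (bandVY μ (σ - t / 2) + bandVY μ (σ + t / 2)) +
          Real.sin (SYP μ P (σ - t / 2) (σ + t / 2)) *
            (bandAY μ (σ - t / 2) * (-(1 / 2)) + bandAY μ (σ + t / 2) * (1 / 2)))) t := by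
  have hm : HasDerivAt (fun s : ℝ => σ - s / 2) (-(1 / 2)) t := by
    have := ((hasDerivAt_id' t).div_const 2).const_sub σ
    exact this.congr_deriv (by ring)
  have hp : HasDerivAt (fun s : ℝ => σ + s / 2) (1 / 2) t := by
    have := ((hasDerivAt_id' t).div_const 2).const_add σ
    exact this.congr_deriv (by ring)
  have hXm₀ := (hasDerivAt_bandX hμ₁ hμ₂ (σ - t / 2)).comp t hm
  have hXm : HasDerivAt (fun s => bandX μ (σ - s / 2)) (bandVX μ (σ - t / 2) * (-(1 / 2))) t := hXm₀
  have hXp₀ := (hasDerivAt_bandX hμ₁ hμ₂ (σ + t / 2)).comp t hp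
  have hXp : HasDerivAt (fun s => bandX μ (σ + s / 2)) (bandVX μ (σ + t / 2) * (1 / 2)) t := hXp₀
  have hYm₀ := (hasDerivAt_bandY hμ₁ hμ₂ (σ - t / 2)).comp t hm
  have hYm : HasDerivAt (fun s => bandY μ (σ - s / 2)) (bandVY μ (σ - t / 2) * (-(1 / 2))) t := hYm₀
  have hYp₀ := (hasDerivAt_bandY hμ₁ hμ₂ (σ + t / 2)).comp t hp
  have hYp : HasDerivAt (fun s => bandY μ (σ + s / 2)) (bandVY μ (σ + t / 2) * (1 / 2)) t := hYp₀
  have hVXm₀ := (hasDerivAt_bandVX hμ₁ hμ₂ (σ - t / 2)).comp t hm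
  have hVXm : HasDerivAt (fun s => bandVX μ (σ - s / 2)) (bandAX μ (σ - t / 2) * (-(1 / 2))) t := hVXm₀
  have hVXp₀ := (hasDerivAt_bandVX hμ₁ hμ₂ (σ + t / 2)).comp t hp
  have hVXp : HasDerivAt (fun s => bandVX μ (σ + s / 2)) (bandAX μ (σ + t / 2) * (1 / 2)) t := hVXp₀
  have hVYm₀ := (hasDerivAt_bandVY hμ₁ hμ₂ (σ - t / 2)).comp t hm
  have hVYm : HasDerivAt (fun s => bandVY μ (σ - s / 2)) (bandAY μ (σ - t / 2) * (-(1 / 2))) t := hVYm₀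
  have hVYp₀ := (hasDerivAt_bandVY hμ₁ hμ₂ (σ + t / 2)).comp t hp
  have hVYp : HasDerivAt (fun s => bandVY μ (σ + s / 2)) (bandAY μ (σ + t / 2) * (1 / 2)) t := hVYp₀
  have hX : HasDerivAt (fun s => SXP μ P (σ - s / 2) (σ + s / 2))
      (bandVX μ (σ - t / 2) * (-(1 / 2)) + bandVX μ (σ + t / 2) * (1 / 2)) t := by
    unfold SXP; exact (hXm.const_add _).fun_add hXp
  have hY : HasDerivAt (fun s => SYP μ P (σ - s / 2) (σ + s / 2))
      (bandVY μ (σ - t / 2) * (-(1 / 2)) + bandVY μ (σ + t / 2) * (1 / 2)) t := by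
    unfold SYP; exact (hYm.const_add _).fun_add hYp
  unfold GfunP
  exact ((hX.sin.fun_mul (hVXm.fun_add hVXp)).const_mul 2).fun_add
    ((hY.sin.fun_mul (hVYm.fun_add hVYp)).const_mul 2)

end Deriv

/-! ### Bounds on the derivatives -/

section DBounds

variable {a b : ℝ} (B : BandBounds a b) {μ : ℝ} (hμ : μ ∈ Icc a b)
include hμ

/-- `|∂₃∂₃ h| ≤ 4 s_max² + 4 A₂`. -/
theorem abs_h33P_le (P : ℝ × ℝ) (θ₂ θ₃ : ℝ) : |h33P μ P θ₂ θ₃| ≤ 4 * B.smax ^ 2 + 4 * B.A2 := by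
  unfold h33P
  have hs := B.smax_pos
  have hvx := B.abs_VX_le μ hμ θ₃; have hvy := B.abs_VY_le μ hμ θ₃
  have hax := B.abs_AX_le μ hμ θ₃; have hay := B.abs_AY_le μ hμ θ₃
  have p1 : |Real.cos (SXP μ P θ₂ θ₃) * bandVX μ θ₃| ≤ B.smax := by
    rw [abs_mul]
    calc _ ≤ 1 * B.smax := mul_le_mul (Real.abs_cos_le_one _) hvx (abs_nonneg _) zero_le_one
      _ = B.smax := one_mul _
  have p2 : |Real.cos (SYP μ P θ₂ θ₃) * bandVY μ θ₃| ≤ B.smax := by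
    rw [abs_mul]
    calc _ ≤ 1 * B.smax := mul_le_mul (Real.abs_cos_le_one _) hvy (abs_nonneg _) zero_le_one
      _ = B.smax := one_mul _
  have e1 : |Real.cos (SXP μ P θ₂ θ₃) * bandVX μ θ₃ * bandVX μ θ₃ + Real.sin (SXP μ P θ₂ θ₃) * bandAX μ θ₃| ≤
      B.smax * B.smax + 1 * B.A2 := abs_two_term_le p1 hvx (Real.abs_sin_le_one _) hax
  have e2 : |Real.cos (SYP μ P θ₂ θ₃) * bandVY μ θ₃ * bandVY μ θ₃ + Real.sin (SYP μ P θ₂ θ₃) * bandAY μ θ₃| ≤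
      B.smax * B.smax + 1 * B.A2 := abs_two_term_le p2 hvy (Real.abs_sin_le_one _) hay
  calc _ ≤ |2 * (Real.cos (SXP μ P θ₂ θ₃) * bandVX μ θ₃ * bandVX μ θ₃ + Real.sin (SXP μ P θ₂ θ₃) * bandAX μ θ₃)| +
        |2 * (Real.cos (SYP μ P θ₂ θ₃) * bandVY μ θ₃ * bandVY μ θ₃ + Real.sin (SYP μ P θ₂ θ₃) * bandAY μ θ₃)| :=
        abs_add_le _ _
    _ ≤ 4 * B.smax ^ 2 + 4 * B.A2 := by rw [abs_mul, abs_mul, abs_two]; nlinarith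

/-- `∂₃ h` is Lipschitz in `θ₃` with constant `4 s_max² + 4 A₂`. -/
theorem abs_h3P_sub_le (P : ℝ × ℝ) (θ₂ z z' : ℝ) :
    |h3P μ P θ₂ z - h3P μ P θ₂ z'| ≤ (4 * B.smax ^ 2 + 4 * B.A2) * |z - z'| := by
  obtain ⟨h1, h2⟩ := B.level hμ
  have h := (convex_univ (𝕜 := ℝ) (E := ℝ)).norm_image_sub_le_of_norm_hasDerivWithin_le
    (f := fun x => h3P μ P θ₂ x) (f' := fun x => h33P μ P θ₂ x)
    (fun t _ => (hasDerivAt_h3P h1 h2 P θ₂ t).hasDerivWithinAt)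
    (fun t _ => by rw [Real.norm_eq_abs]; exact abs_h33P_le B hμ P θ₂ t) (mem_univ z') (mem_univ z)
  rw [Real.norm_eq_abs, Real.norm_eq_abs] at h
  exact h

/-- `|∂_t ĥ| ≤ 2 A₂ |t|` along the anti-diagonal. -/
theorem abs_anti_derivP_le (P : ℝ × ℝ) (σ t : ℝ) :
    |Real.sin (SXP μ P (σ - t / 2) (σ + t / 2)) * (bandVX μ (σ + t / 2) - bandVX μ (σ - t / 2)) +
        Real.sin (SYP μ P (σ - t / 2) (σ + t / 2)) * (bandVY μ (σ + t / 2) - bandVY μ (σ - t / 2))| ≤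
      2 * B.A2 * |t| := by
  have hx := abs_bandVX_sub_le B hμ (σ + t / 2) (σ - t / 2)
  have hy := abs_bandVY_sub_le B hμ (σ + t / 2) (σ - t / 2)
  rw [show σ + t / 2 - (σ - t / 2) = t by ring] at hx hy
  have := abs_two_term_le (Real.abs_sin_le_one _) hx (Real.abs_sin_le_one _) hy
    (p := Real.sin (SXP μ P (σ - t / 2) (σ + t / 2))) (q := Real.sin (SYP μ P (σ - t / 2) (σ + t / 2)))
  linarith

/-- `G` is Lipschitz in `t` with constant `8 s_max² + 4 A₂`. -/
theorem abs_GfunP_sub_le (P : ℝ × ℝ) (σ t t' : ℝ) : |GfunP μ P σ t - GfunP μ P σ t'| ≤ (8 * B.smax ^ 2 + 4 * B.A2) * |t - t'| := by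
  obtain ⟨h1, h2⟩ := B.level hμ
  have hs := B.smax_pos; have hA := B.A2_pos
  have hbound : ∀ u : ℝ,
      |2 * (Real.cos (SXP μ P (σ - u / 2) (σ + u / 2)) *
            (bandVX μ (σ - u / 2) * (-(1 / 2)) + bandVX μ (σ + u / 2) * (1 / 2)) *
            (bandVX μ (σ - u / 2) + bandVX μ (σ + u / 2)) +
          Real.sin (SXP μ P (σ - u / 2) (σ + u / 2)) *
            (bandAX μ (σ - u / 2) * (-(1 / 2)) + bandAX μ (σ + u / 2) * (1 / 2))) +
        2 * (Real.cos (SYP μ P (σ - u / 2) (σ + u / 2)) *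
            (bandVY μ (σ - u / 2) * (-(1 / 2)) + bandVY μ (σ + u / 2) * (1 / 2)) *
            (bandVY μ (σ - u / 2) + bandVY μ (σ + u / 2)) +
          Real.sin (SYP μ P (σ - u / 2) (σ + u / 2)) *
            (bandAY μ (σ - u / 2) * (-(1 / 2)) + bandAY μ (σ + u / 2) * (1 / 2)))| ≤ 8 * B.smax ^ 2 + 4 * B.A2 := by
    intro u
    have v1 := B.abs_VX_le μ hμ (σ - u / 2); have v2 := B.abs_VX_le μ hμ (σ + u / 2)
    have v3 := B.abs_VY_le μ hμ (σ - u / 2); have v4 := B.abs_VY_le μ hμ (σ + u / 2)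
    have a1 := B.abs_AX_le μ hμ (σ - u / 2); have a2 := B.abs_AX_le μ hμ (σ + u / 2)
    have a3 := B.abs_AY_le μ hμ (σ - u / 2); have a4 := B.abs_AY_le μ hμ (σ + u / 2)
    have d1 : |bandVX μ (σ - u / 2) * (-(1 / 2)) + bandVX μ (σ + u / 2) * (1 / 2)| ≤ B.smax := by
      have := abs_two_term_le v1 (by norm_num : |(-(1/2) : ℝ)| ≤ 1 / 2) v2 (by norm_num : |((1/2) : ℝ)| ≤ 1 / 2)
      linarith
    have d2 : |bandVY μ (σ - u / 2) * (-(1 / 2)) + bandVY μ (σ + u / 2) * (1 / 2)| ≤ B.smax := by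
      have := abs_two_term_le v3 (by norm_num : |(-(1/2) : ℝ)| ≤ 1 / 2) v4 (by norm_num : |((1/2) : ℝ)| ≤ 1 / 2)
      linarith
    have d3 : |bandAX μ (σ - u / 2) * (-(1 / 2)) + bandAX μ (σ + u / 2) * (1 / 2)| ≤ B.A2 := by
      have := abs_two_term_le a1 (by norm_num : |(-(1/2) : ℝ)| ≤ 1 / 2) a2 (by norm_num : |((1/2) : ℝ)| ≤ 1 / 2)
      linarith
    have d4 : |bandAY μ (σ - u / 2) * (-(1 / 2)) + bandAY μ (σ + u / 2) * (1 / 2)| ≤ B.A2 := by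
      have := abs_two_term_le a3 (by norm_num : |(-(1/2) : ℝ)| ≤ 1 / 2) a4 (by norm_num : |((1/2) : ℝ)| ≤ 1 / 2)
      linarith
    have s1 : |bandVX μ (σ - u / 2) + bandVX μ (σ + u / 2)| ≤ 2 * B.smax := (abs_add_le _ _).trans (by linarith)
    have s2 : |bandVY μ (σ - u / 2) + bandVY μ (σ + u / 2)| ≤ 2 * B.smax := (abs_add_le _ _).trans (by linarith)
    have pd1 : |Real.cos (SXP μ P (σ - u / 2) (σ + u / 2)) *
        (bandVX μ (σ - u / 2) * (-(1 / 2)) + bandVX μ (σ + u / 2) * (1 / 2))| ≤ B.smax := by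
      rw [abs_mul]
      calc _ ≤ 1 * B.smax := mul_le_mul (Real.abs_cos_le_one _) d1 (abs_nonneg _) zero_le_one
        _ = B.smax := one_mul _
    have pd2 : |Real.cos (SYP μ P (σ - u / 2) (σ + u / 2)) *
        (bandVY μ (σ - u / 2) * (-(1 / 2)) + bandVY μ (σ + u / 2) * (1 / 2))| ≤ B.smax := by
      rw [abs_mul]
      calc _ ≤ 1 * B.smax := mul_le_mul (Real.abs_cos_le_one _) d2 (abs_nonneg _) zero_le_one
        _ = B.smax := one_mul _
    have t1 : |Real.cos (SXP μ P (σ - u / 2) (σ + u / 2)) *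
            (bandVX μ (σ - u / 2) * (-(1 / 2)) + bandVX μ (σ + u / 2) * (1 / 2)) *
            (bandVX μ (σ - u / 2) + bandVX μ (σ + u / 2)) +
          Real.sin (SXP μ P (σ - u / 2) (σ + u / 2)) *
            (bandAX μ (σ - u / 2) * (-(1 / 2)) + bandAX μ (σ + u / 2) * (1 / 2))| ≤ B.smax * (2 * B.smax) + 1 * B.A2 :=
      abs_two_term_le pd1 s1 (Real.abs_sin_le_one _) d3
    have t2 : |Real.cos (SYP μ P (σ - u / 2) (σ + u / 2)) *
            (bandVY μ (σ - u / 2) * (-(1 / 2)) + bandVY μ (σ + u / 2) * (1 / 2)) *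
            (bandVY μ (σ - u / 2) + bandVY μ (σ + u / 2)) +
          Real.sin (SYP μ P (σ - u / 2) (σ + u / 2)) *
            (bandAY μ (σ - u / 2) * (-(1 / 2)) + bandAY μ (σ + u / 2) * (1 / 2))| ≤ B.smax * (2 * B.smax) + 1 * B.A2 :=
      abs_two_term_le pd2 s2 (Real.abs_sin_le_one _) d4
    calc _ ≤ |2 * (Real.cos (SXP μ P (σ - u / 2) (σ + u / 2)) *
            (bandVX μ (σ - u / 2) * (-(1 / 2)) + bandVX μ (σ + u / 2) * (1 / 2)) *
            (bandVX μ (σ - u / 2) + bandVX μ (σ + u / 2)) +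
          Real.sin (SXP μ P (σ - u / 2) (σ + u / 2)) *
            (bandAX μ (σ - u / 2) * (-(1 / 2)) + bandAX μ (σ + u / 2) * (1 / 2)))| +
        |2 * (Real.cos (SYP μ P (σ - u / 2) (σ + u / 2)) *
            (bandVY μ (σ - u / 2) * (-(1 / 2)) + bandVY μ (σ + u / 2) * (1 / 2)) *
            (bandVY μ (σ - u / 2) + bandVY μ (σ + u / 2)) +
          Real.sin (SYP μ P (σ - u / 2) (σ + u / 2)) *
            (bandAY μ (σ - u / 2) * (-(1 / 2)) + bandAY μ (σ + u / 2) * (1 / 2)))| := abs_add_le _ _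
      _ ≤ 8 * B.smax ^ 2 + 4 * B.A2 := by rw [abs_mul, abs_mul, abs_two]; nlinarith
  have h := (convex_univ (𝕜 := ℝ) (E := ℝ)).norm_image_sub_le_of_norm_hasDerivWithin_le
    (f := fun x => GfunP μ P σ x)
    (fun u _ => (hasDerivAt_GfunP h1 h2 P σ u).hasDerivWithinAt)
    (fun u _ => by rw [Real.norm_eq_abs]; exact hbound u) (mem_univ t') (mem_univ t)
  rw [Real.norm_eq_abs, Real.norm_eq_abs] at h
  exact h

/-- `|H'| ≤ 8 s_max` for the diagonal function. -/
theorem abs_diag_derivP_le (P : ℝ × ℝ) (σ : ℝ) :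
    |4 * (Real.sin (SXP μ P σ σ) * bandVX μ σ + Real.sin (SYP μ P σ σ) * bandVY μ σ)| ≤ 8 * B.smax := by
  have := abs_two_term_le (Real.abs_sin_le_one (SXP μ P σ σ)) (B.abs_VX_le μ hμ σ)
    (Real.abs_sin_le_one (SYP μ P σ σ)) (B.abs_VY_le μ hμ σ)
  rw [abs_mul, show |(4:ℝ)| = 4 by norm_num]; linarith

/-- `|H''| ≤ 16 s_max² + 8 A₂` for the diagonal function. -/
theorem abs_diag_deriv2P_le (P : ℝ × ℝ) (σ : ℝ) :
    |8 * (Real.cos (SXP μ P σ σ) * bandVX μ σ ^ 2 + Real.cos (SYP μ P σ σ) * bandVY μ σ ^ 2) +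
        4 * (Real.sin (SXP μ P σ σ) * bandAX μ σ + Real.sin (SYP μ P σ σ) * bandAY μ σ)| ≤
      16 * B.smax ^ 2 + 8 * B.A2 := by
  have hs := B.smax_pos
  have hvx := B.abs_VX_le μ hμ σ; have hvy := B.abs_VY_le μ hμ σ
  have hsq1 : |bandVX μ σ ^ 2| ≤ B.smax ^ 2 := by
    rw [abs_pow, sq, sq]; exact mul_le_mul hvx hvx (abs_nonneg _) hs.le
  have hsq2 : |bandVY μ σ ^ 2| ≤ B.smax ^ 2 := by
    rw [abs_pow, sq, sq]; exact mul_le_mul hvy hvy (abs_nonneg _) hs.le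
  have e1 := abs_two_term_le (Real.abs_cos_le_one (SXP μ P σ σ)) hsq1 (Real.abs_cos_le_one (SYP μ P σ σ)) hsq2
  have e2 := abs_two_term_le (Real.abs_sin_le_one (SXP μ P σ σ)) (B.abs_AX_le μ hμ σ)
    (Real.abs_sin_le_one (SYP μ P σ σ)) (B.abs_AY_le μ hμ σ)
  calc _ ≤ |8 * (Real.cos (SXP μ P σ σ) * bandVX μ σ ^ 2 + Real.cos (SYP μ P σ σ) * bandVY μ σ ^ 2)| +
        |4 * (Real.sin (SXP μ P σ σ) * bandAX μ σ + Real.sin (SYP μ P σ σ) * bandAY μ σ)| := abs_add_le _ _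
    _ ≤ 16 * B.smax ^ 2 + 8 * B.A2 := by
        rw [abs_mul, abs_mul, show |(8:ℝ)| = 8 by norm_num, show |(4:ℝ)| = 4 by norm_num]; linarith

end DBounds

end Summit.HubbardSuperconductivity.HubbardSuperconductivity.Theorems.CountPairsOffset

end
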